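import Mathlib

/-!
# Theta-body kernels on block pairs: preliminaries (support file)

Crux `stmt-MatrixMultiplication-14309` (`FourierTwoFamiliesModP.PrimeCyclicPowerGain`), line
`clique-coclique-direct-sum-clique`.  The line's bet `stub_thetaBound` is a uniform bound on the value
`∑ v, ∑ w, B v w` of "feasible kernels" `B : V → V → ℝ`, `V = Finset G × Finset G` (block pairs), given only
through RAW finite-sum hypotheses (symmetry, positivity of the real quadratic form, trace, support).  This file
is the bookkeeping layer shared by every argument about such kernels and closes the registered milestone stub
`stub_thetaFluctEnergy` (the fluctuation-energy identity, milestone 1a of `stub_thetaBound`); the sibling file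
`…ThetaHalfDensity` uses it to prove the `ϑ`-HalfDensity calibration (`stub_thetaHalfDensity`).

* namespace `…Kernel` — `diag_nonneg_of_psd` (diagonal of a PSD kernel is `≥ 0`) and the polarisation /
  AM–GM inequality `neg_add_le_two_mul_cross_of_psd : -(xᵀBx + yᵀBy) ≤ 2·xᵀBy` (square-root-free
  Cauchy–Schwarz), for an arbitrary finite index type;
* namespace `…Rep` — the difference-representation function `rep v w x = #{(a,b) ∈ v.1 × w.2 : a − b = x}`
  (as a real double `if`-sum): `sum_rep`, `mem_sub_of_rep_ne_zero`, `rep_le_one_of_direct` (clause (W)),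
  `rep_eq_sum_indicator` (convolution form), indicator / fluctuation sums `sum_ind_mul_ind`, `sum_fluct`,
  `sum_fluct_mul_fluct`, the reindexing `sum_sub_arg`, over any finite additive commutative group;
* namespace `…Fluct` — `F_eq_sum` (convolution form of `Σ B·rep`) and the fluctuation energies
  `fluctA_energy` / `fluctB_energy`: `Σ_y Σ_{v,w} f̃_v(y) B_vw f̃_w(y) = s·tr B − (s²/|G|)·Σ B` whenever the
  nonzero entries of `B` sit on blocks of side-size `s` with pairwise disjoint first (resp. second) sides —
  which is what compatibility in the conflict graph provides.

Mathlib's `Matrix.PosSemidef` API is deliberately not used: the stub quantifies over bare functions with the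
positivity hypothesis stated as a `Finset.univ` double sum.
-/
namespace Summit.MatrixMultiplication.MatrixMultiplication.Theorems.PrimeCyclicPowerGainTheta.Kernel

open scoped BigOperators

variable {V : Type*} [Fintype V]

/-- The symmetric bilinear pairing `∑ v, ∑ w, x v * B v w * y w` is symmetric in `x, y` when `B` is. -/
theorem cross_comm (B : V → V → ℝ) (hsymm : ∀ v w, B v w = B w v) (x y : V → ℝ) :
    ∑ v, ∑ w, x v * B v w * y w = ∑ v, ∑ w, y v * B v w * x w := by
  rw [Finset.sum_comm]
  refine Finset.sum_congr rfl fun v _ => Finset.sum_congr rfl fun w _ => ?_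
  rw [hsymm w v]; ring

/-- Expansion of the quadratic form at `x + y`:
`(x+y)ᵀB(x+y) = xᵀBx + yᵀBy + 2 xᵀBy` for a symmetric kernel. -/
theorem quad_add (B : V → V → ℝ) (hsymm : ∀ v w, B v w = B w v) (x y : V → ℝ) :
    ∑ v, ∑ w, (x v + y v) * B v w * (x w + y w) =
      ∑ v, ∑ w, x v * B v w * x w + ∑ v, ∑ w, y v * B v w * y w +
        2 * ∑ v, ∑ w, x v * B v w * y w := by
  have hc := cross_comm B hsymm x y
  have hsplit : ∑ v, ∑ w, (x v + y v) * B v w * (x w + y w) =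
      ∑ v, ∑ w, x v * B v w * x w + ∑ v, ∑ w, y v * B v w * y w +
        (∑ v, ∑ w, x v * B v w * y w + ∑ v, ∑ w, y v * B v w * x w) := by
    simp only [← Finset.sum_add_distrib]
    refine Finset.sum_congr rfl fun v _ => Finset.sum_congr rfl fun w _ => ?_
    ring
  rw [hsplit, ← hc]; ring

/-- **Diagonal entries of a PSD kernel are nonnegative**: test the quadratic form on the indicator of `v`. -/
theorem diag_nonneg_of_psd [DecidableEq V] (B : V → V → ℝ)
    (hpsd : ∀ x : V → ℝ, 0 ≤ ∑ v, ∑ w, x v * B v w * x w) (v : V) : 0 ≤ B v v := by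
  have h := hpsd fun u => if u = v then 1 else 0
  have hv : ∑ u, ∑ w, (if u = v then (1:ℝ) else 0) * B u w * (if w = v then 1 else 0) = B v v := by
    rw [Finset.sum_eq_single v]
    · rw [Finset.sum_eq_single v]
      · simp
      · intro w _ hw; simp [hw]
      · intro h'; exact absurd (Finset.mem_univ v) h'
    · intro u _ hu; simp [hu]
    · intro h'; exact absurd (Finset.mem_univ v) h'
  rw [hv] at h; exact h

/-- **Polarisation / AM–GM for a PSD symmetric kernel** (square-root-free Cauchy–Schwarz):
`-(xᵀBx + yᵀBy) ≤ 2 · xᵀBy`, from `0 ≤ (x+y)ᵀB(x+y)`. -/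
theorem neg_add_le_two_mul_cross_of_psd (B : V → V → ℝ) (hsymm : ∀ v w, B v w = B w v)
    (hpsd : ∀ x : V → ℝ, 0 ≤ ∑ v, ∑ w, x v * B v w * x w) (x y : V → ℝ) :
    -(∑ v, ∑ w, x v * B v w * x w + ∑ v, ∑ w, y v * B v w * y w) ≤
      2 * ∑ v, ∑ w, x v * B v w * y w := by
  have h := hpsd (fun v => x v + y v)
  have hq := quad_add B hsymm x y
  rw [hq] at h
  linarith

end Summit.MatrixMultiplication.MatrixMultiplication.Theorems.PrimeCyclicPowerGainTheta.Kernel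

namespace Summit.MatrixMultiplication.MatrixMultiplication.Theorems.PrimeCyclicPowerGainTheta.Rep

open scoped BigOperators Pointwise

variable {G : Type*} [AddCommGroup G] [Fintype G] [DecidableEq G]

omit [Fintype G] in
/-- `rep v w x = #{(a,b) ∈ v.1 × w.2 : a − b = x}` (as a real double `if`-sum) is nonnegative. -/
theorem rep_nonneg (v w : Finset G × Finset G) (x : G) :
    (0 : ℝ) ≤ ∑ a ∈ v.1, ∑ b ∈ w.2, (if a - b = x then (1 : ℝ) else 0) :=
  Finset.sum_nonneg fun _ _ => Finset.sum_nonneg fun _ _ => by split_ifs <;> norm_num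

/-- Every pair `(a,b)` has exactly one difference: `∑ₓ rep v w x = |v.1| · |w.2|`. -/
theorem sum_rep (v w : Finset G × Finset G) :
    ∑ x, ∑ a ∈ v.1, ∑ b ∈ w.2, (if a - b = x then (1 : ℝ) else 0) =
      (v.1.card : ℝ) * (w.2.card : ℝ) := by
  rw [Finset.sum_comm]
  have h1 : ∀ a ∈ v.1, ∑ x, ∑ b ∈ w.2, (if a - b = x then (1 : ℝ) else 0) = (w.2.card : ℝ) := by
    intro a _
    rw [Finset.sum_comm]
    have h2 : ∀ b ∈ w.2, ∑ x, (if a - b = x then (1 : ℝ) else 0) = 1 := by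
      intro b _
      rw [Finset.sum_ite_eq]; simp
    rw [Finset.sum_congr rfl h2]; simp
  rw [Finset.sum_congr rfl h1]; simp

omit [Fintype G] in
/-- A represented difference lies in the difference set: `rep v w x ≠ 0 → x ∈ v.1 − w.2`. -/
theorem mem_sub_of_rep_ne_zero (v w : Finset G × Finset G) (x : G)
    (h : ∑ a ∈ v.1, ∑ b ∈ w.2, (if a - b = x then (1 : ℝ) else 0) ≠ 0) : x ∈ v.1 - w.2 := by
  obtain ⟨a, ha, ha'⟩ := Finset.exists_ne_zero_of_sum_ne_zero h
  obtain ⟨b, hb, hb'⟩ := Finset.exists_ne_zero_of_sum_ne_zero ha'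
  have hab : a - b = x := by
    by_contra hne; exact hb' (if_neg hne)
  rw [← hab]
  exact Finset.sub_mem_sub ha hb

omit [Fintype G] in
/-- Clause (W) (directness of the pair `v`) makes the self-representation function `0/1`-valued:
`rep v v x ≤ 1`. -/
theorem rep_le_one_of_direct (v : Finset G × Finset G)
    (hW : ∀ a ∈ v.1, ∀ a' ∈ v.1, ∀ b ∈ v.2, ∀ b' ∈ v.2, (a - a') + (b - b') = 0 → a = a' ∧ b = b')
    (x : G) :
    ∑ a ∈ v.1, ∑ b ∈ v.2, (if a - b = x then (1 : ℝ) else 0) ≤ 1 := by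
  rw [← Finset.sum_product' (f := fun a b => if a - b = x then (1 : ℝ) else 0)]
  rw [Finset.sum_boole]
  have hcard : ((v.1 ×ˢ v.2).filter (fun ab : G × G => ab.1 - ab.2 = x)).card ≤ 1 := by
    apply Finset.card_le_one.2
    intro ab hab ab' hab'
    rw [Finset.mem_filter, Finset.mem_product] at hab hab'
    obtain ⟨⟨ha, hb⟩, h1⟩ := hab
    obtain ⟨⟨ha', hb'⟩, h2⟩ := hab'
    have h0 : (ab.1 - ab'.1) + (ab'.2 - ab.2) = 0 := by
      have e : (ab.1 - ab'.1) + (ab'.2 - ab.2) = (ab.1 - ab.2) - (ab'.1 - ab'.2) := by abel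
      rw [e, h1, h2, sub_self]
    obtain ⟨e1, e2⟩ := hW ab.1 ha ab'.1 ha' ab'.2 hb' ab.2 hb h0
    exact Prod.ext e1 e2.symm
  exact_mod_cast hcard

/-- Convolution form: `rep v w x = ∑_y 1[y ∈ v.1] · 1[y − x ∈ w.2]`. -/
theorem rep_eq_sum_indicator (v w : Finset G × Finset G) (x : G) :
    ∑ a ∈ v.1, ∑ b ∈ w.2, (if a - b = x then (1 : ℝ) else 0) =
      ∑ y, (if y ∈ v.1 then (1 : ℝ) else 0) * (if y - x ∈ w.2 then (1 : ℝ) else 0) := by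
  have hin : ∀ a ∈ v.1, ∑ b ∈ w.2, (if a - b = x then (1 : ℝ) else 0) =
      if a - x ∈ w.2 then 1 else 0 := by
    intro a _
    have : ∀ b ∈ w.2, (if a - b = x then (1 : ℝ) else 0) = if a - x = b then 1 else 0 := by
      intro b _
      by_cases h : a - b = x
      · rw [if_pos h, if_pos (by rw [← h]; abel)]
      · rw [if_neg h, if_neg (by intro h'; apply h; rw [← h']; abel)]
    rw [Finset.sum_congr rfl this, Finset.sum_ite_eq]
  rw [Finset.sum_congr rfl hin]
  symm
  rw [show ∑ y, (if y ∈ v.1 then (1 : ℝ) else 0) * (if y - x ∈ w.2 then (1 : ℝ) else 0) =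
      ∑ y, (if y ∈ v.1 then (if y - x ∈ w.2 then (1 : ℝ) else 0) else 0) from
    Finset.sum_congr rfl fun y _ => by split_ifs <;> simp]
  rw [Finset.sum_ite_mem, Finset.univ_inter]

omit [AddCommGroup G] in
/-- `∑_y 1_S(y) · 1_T(y) = |S ∩ T|`. -/
theorem sum_ind_mul_ind (S T : Finset G) :
    ∑ y, (if y ∈ S then (1 : ℝ) else 0) * (if y ∈ T then (1 : ℝ) else 0) = ((S ∩ T).card : ℝ) := by
  rw [show ∑ y, (if y ∈ S then (1 : ℝ) else 0) * (if y ∈ T then (1 : ℝ) else 0) =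
      ∑ y, (if y ∈ S ∩ T then (1 : ℝ) else 0) from
    Finset.sum_congr rfl fun y _ => by
      by_cases hS : y ∈ S <;> by_cases hT : y ∈ T <;> simp [hS, hT]]
  rw [Finset.sum_boole]
  congr 2
  ext y; simp

omit [AddCommGroup G] in
/-- `∑_y 1_S(y) = |S|`. -/
theorem sum_ind (S : Finset G) : ∑ y, (if y ∈ S then (1 : ℝ) else 0) = (S.card : ℝ) := by
  rw [Finset.sum_boole]
  congr 2
  ext y; simp

omit [DecidableEq G] in
/-- Reindexing by a translation: `∑_y f (y − x) = ∑_y f y`. -/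
theorem sum_sub_arg (f : G → ℝ) (x : G) : ∑ y, f (y - x) = ∑ y, f y :=
  Fintype.sum_equiv (Equiv.subRight x) _ _ fun _ => rfl

/-- The fluctuation `1_S − |S|/|G|` has mean zero. -/
theorem sum_fluct (S : Finset G) :
    ∑ y, ((if y ∈ S then (1 : ℝ) else 0) - (S.card : ℝ) / (Fintype.card G : ℝ)) = 0 := by
  have hG : (0 : ℝ) < Fintype.card G := by exact_mod_cast Fintype.card_pos
  rw [Finset.sum_sub_distrib, sum_ind, Finset.sum_const, Finset.card_univ, nsmul_eq_mul]
  field_simp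
  ring

/-- Correlation of two fluctuations: `∑_y (1_S − |S|/|G|)(1_T − |T|/|G|) = |S ∩ T| − |S||T|/|G|`. -/
theorem sum_fluct_mul_fluct (S T : Finset G) :
    ∑ y, ((if y ∈ S then (1 : ℝ) else 0) - (S.card : ℝ) / (Fintype.card G : ℝ)) *
        ((if y ∈ T then (1 : ℝ) else 0) - (T.card : ℝ) / (Fintype.card G : ℝ)) =
      ((S ∩ T).card : ℝ) - (S.card : ℝ) * (T.card : ℝ) / (Fintype.card G : ℝ) := by
  have hG : (0 : ℝ) < Fintype.card G := by exact_mod_cast Fintype.card_pos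
  have hexp : ∀ y : G, ((if y ∈ S then (1 : ℝ) else 0) - (S.card : ℝ) / (Fintype.card G : ℝ)) *
        ((if y ∈ T then (1 : ℝ) else 0) - (T.card : ℝ) / (Fintype.card G : ℝ)) =
      (if y ∈ S then (1 : ℝ) else 0) * (if y ∈ T then (1 : ℝ) else 0)
        - ((T.card : ℝ) / (Fintype.card G : ℝ)) * (if y ∈ S then (1 : ℝ) else 0)
        - ((S.card : ℝ) / (Fintype.card G : ℝ)) * (if y ∈ T then (1 : ℝ) else 0)
        + (S.card : ℝ) / (Fintype.card G : ℝ) * ((T.card : ℝ) / (Fintype.card G : ℝ)) := by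
    intro y; ring
  rw [Finset.sum_congr rfl fun y _ => hexp y, Finset.sum_add_distrib, Finset.sum_sub_distrib,
    Finset.sum_sub_distrib, sum_ind_mul_ind, ← Finset.mul_sum, ← Finset.mul_sum, sum_ind, sum_ind,
    Finset.sum_const, Finset.card_univ, nsmul_eq_mul]
  field_simp
  ring

end Summit.MatrixMultiplication.MatrixMultiplication.Theorems.PrimeCyclicPowerGainTheta.Rep

namespace Summit.MatrixMultiplication.MatrixMultiplication.Theorems.PrimeCyclicPowerGainTheta.Fluct

open scoped BigOperators Pointwise
open Summit.MatrixMultiplication.MatrixMultiplication.Theorems.PrimeCyclicPowerGainTheta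

variable {G : Type*} [AddCommGroup G] [Fintype G] [DecidableEq G]

/-- Convolution form of `F`: `F(x) = Σ_y Σ_{v,w} 1[y ∈ v.1] · B v w · 1[y − x ∈ w.2]`. -/
theorem F_eq_sum (B : Finset G × Finset G → Finset G × Finset G → ℝ) (x : G) :
    ∑ v, ∑ w, B v w * ∑ a ∈ v.1, ∑ b ∈ w.2, (if a - b = x then (1 : ℝ) else 0) =
      ∑ y, ∑ v, ∑ w, (if y ∈ v.1 then (1 : ℝ) else 0) * B v w * (if y - x ∈ w.2 then (1 : ℝ) else 0) := by
  have h : ∀ v w : Finset G × Finset G,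
      B v w * ∑ a ∈ v.1, ∑ b ∈ w.2, (if a - b = x then (1 : ℝ) else 0) =
        ∑ y, (if y ∈ v.1 then (1 : ℝ) else 0) * B v w * (if y - x ∈ w.2 then (1 : ℝ) else 0) := by
    intro v w
    rw [Rep.rep_eq_sum_indicator, Finset.mul_sum]
    apply Finset.sum_congr rfl
    intro y _
    ring
  calc ∑ v, ∑ w, B v w * ∑ a ∈ v.1, ∑ b ∈ w.2, (if a - b = x then (1 : ℝ) else 0)
      = ∑ v, ∑ w, ∑ y, (if y ∈ v.1 then (1 : ℝ) else 0) * B v w *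
          (if y - x ∈ w.2 then (1 : ℝ) else 0) :=
        Finset.sum_congr rfl fun v _ => Finset.sum_congr rfl fun w _ => h v w
    _ = ∑ v, ∑ y, ∑ w, (if y ∈ v.1 then (1 : ℝ) else 0) * B v w *
          (if y - x ∈ w.2 then (1 : ℝ) else 0) :=
        Finset.sum_congr rfl fun v _ => Finset.sum_comm
    _ = ∑ y, ∑ v, ∑ w, (if y ∈ v.1 then (1 : ℝ) else 0) * B v w *
          (if y - x ∈ w.2 then (1 : ℝ) else 0) := Finset.sum_comm

/-- The `A`-side fluctuation energy: `Σ_y Σ_{v,w} f̃_v(y) B_vw f̃_w(y) = s − s²X/|G|`, where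
`f̃_v = 1_{v.1} − |v.1|/|G|`; uses: blocks in the support have `|·.1| = s`, and two DISTINCT blocks carrying
a nonzero entry have disjoint `A`-sides. -/
theorem fluctA_energy (s : ℕ) (B : Finset G × Finset G → Finset G × Finset G → ℝ)
    (hcA : ∀ v w : Finset G × Finset G, B v w ≠ 0 → v.1.card = s ∧ w.1.card = s)
    (hdA : ∀ v w : Finset G × Finset G, B v w ≠ 0 → v ≠ w → Disjoint v.1 w.1) :
    ∑ y, ∑ v, ∑ w,
        ((if y ∈ v.1 then (1 : ℝ) else 0) - (v.1.card : ℝ) / (Fintype.card G : ℝ)) * B v w *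
          ((if y ∈ w.1 then (1 : ℝ) else 0) - (w.1.card : ℝ) / (Fintype.card G : ℝ)) =
      (s : ℝ) * ∑ v, B v v - (s : ℝ) ^ 2 / (Fintype.card G : ℝ) * ∑ v, ∑ w, B v w := by
  rw [Finset.sum_comm]
  have h1 : ∀ v ∈ (Finset.univ : Finset (Finset G × Finset G)),
      ∑ y, ∑ w, ((if y ∈ v.1 then (1 : ℝ) else 0) - (v.1.card : ℝ) / (Fintype.card G : ℝ)) * B v w *
          ((if y ∈ w.1 then (1 : ℝ) else 0) - (w.1.card : ℝ) / (Fintype.card G : ℝ)) =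
        ∑ w, B v w * ((if v = w then (s : ℝ) else 0) - (s : ℝ) ^ 2 / (Fintype.card G : ℝ)) := by
    intro v _
    rw [Finset.sum_comm]
    apply Finset.sum_congr rfl
    intro w _
    have hre : ∀ y : G, ((if y ∈ v.1 then (1 : ℝ) else 0) - (v.1.card : ℝ) / (Fintype.card G : ℝ)) *
          B v w * ((if y ∈ w.1 then (1 : ℝ) else 0) - (w.1.card : ℝ) / (Fintype.card G : ℝ)) =
        B v w * (((if y ∈ v.1 then (1 : ℝ) else 0) - (v.1.card : ℝ) / (Fintype.card G : ℝ)) *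
          ((if y ∈ w.1 then (1 : ℝ) else 0) - (w.1.card : ℝ) / (Fintype.card G : ℝ))) := by
      intro y; ring
    rw [Finset.sum_congr rfl fun y _ => hre y, ← Finset.mul_sum, Rep.sum_fluct_mul_fluct]
    by_cases hB : B v w = 0
    · rw [hB, zero_mul, zero_mul]
    · obtain ⟨hv, hw⟩ := hcA v w hB
      by_cases hvw : v = w
      · subst hvw
        rw [Finset.inter_self, if_pos rfl, hv]; ring
      · rw [Finset.disjoint_iff_inter_eq_empty.1 (hdA v w hB hvw), if_neg hvw, hv, hw,
          Finset.card_empty]; push_cast; ring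
  rw [Finset.sum_congr rfl h1]
  have h2 : ∀ v ∈ (Finset.univ : Finset (Finset G × Finset G)),
      ∑ w, B v w * ((if v = w then (s : ℝ) else 0) - (s : ℝ) ^ 2 / (Fintype.card G : ℝ)) =
        (s : ℝ) * B v v - (s : ℝ) ^ 2 / (Fintype.card G : ℝ) * ∑ w, B v w := by
    intro v _
    simp only [mul_sub, Finset.sum_sub_distrib, mul_ite, mul_zero]
    rw [Finset.sum_ite_eq]
    simp only [Finset.mem_univ, if_true]
    rw [Finset.mul_sum]
    congr 1
    · ring
    · apply Finset.sum_congr rfl; intro w _; ring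
  rw [Finset.sum_congr rfl h2, Finset.sum_sub_distrib, ← Finset.mul_sum, ← Finset.mul_sum]

/-- The `B`-side fluctuation energy (mirror of `fluctA_energy`, same proof on the second sides). -/
theorem fluctB_energy (s : ℕ) (B : Finset G × Finset G → Finset G × Finset G → ℝ)
    (hcB : ∀ v w : Finset G × Finset G, B v w ≠ 0 → v.2.card = s ∧ w.2.card = s)
    (hdB : ∀ v w : Finset G × Finset G, B v w ≠ 0 → v ≠ w → Disjoint v.2 w.2) :
    ∑ y, ∑ v, ∑ w,
        ((if y ∈ v.2 then (1 : ℝ) else 0) - (v.2.card : ℝ) / (Fintype.card G : ℝ)) * B v w *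
          ((if y ∈ w.2 then (1 : ℝ) else 0) - (w.2.card : ℝ) / (Fintype.card G : ℝ)) =
      (s : ℝ) * ∑ v, B v v - (s : ℝ) ^ 2 / (Fintype.card G : ℝ) * ∑ v, ∑ w, B v w := by
  rw [Finset.sum_comm]
  have h1 : ∀ v ∈ (Finset.univ : Finset (Finset G × Finset G)),
      ∑ y, ∑ w, ((if y ∈ v.2 then (1 : ℝ) else 0) - (v.2.card : ℝ) / (Fintype.card G : ℝ)) * B v w *
          ((if y ∈ w.2 then (1 : ℝ) else 0) - (w.2.card : ℝ) / (Fintype.card G : ℝ)) =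
        ∑ w, B v w * ((if v = w then (s : ℝ) else 0) - (s : ℝ) ^ 2 / (Fintype.card G : ℝ)) := by
    intro v _
    rw [Finset.sum_comm]
    apply Finset.sum_congr rfl
    intro w _
    have hre : ∀ y : G, ((if y ∈ v.2 then (1 : ℝ) else 0) - (v.2.card : ℝ) / (Fintype.card G : ℝ)) *
          B v w * ((if y ∈ w.2 then (1 : ℝ) else 0) - (w.2.card : ℝ) / (Fintype.card G : ℝ)) =
        B v w * (((if y ∈ v.2 then (1 : ℝ) else 0) - (v.2.card : ℝ) / (Fintype.card G : ℝ)) *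
          ((if y ∈ w.2 then (1 : ℝ) else 0) - (w.2.card : ℝ) / (Fintype.card G : ℝ))) := by
      intro y; ring
    rw [Finset.sum_congr rfl fun y _ => hre y, ← Finset.mul_sum, Rep.sum_fluct_mul_fluct]
    by_cases hB : B v w = 0
    · rw [hB, zero_mul, zero_mul]
    · obtain ⟨hv, hw⟩ := hcB v w hB
      by_cases hvw : v = w
      · subst hvw
        rw [Finset.inter_self, if_pos rfl, hv]; ring
      · rw [Finset.disjoint_iff_inter_eq_empty.1 (hdB v w hB hvw), if_neg hvw, hv, hw,
          Finset.card_empty]; push_cast; ring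
  rw [Finset.sum_congr rfl h1]
  have h2 : ∀ v ∈ (Finset.univ : Finset (Finset G × Finset G)),
      ∑ w, B v w * ((if v = w then (s : ℝ) else 0) - (s : ℝ) ^ 2 / (Fintype.card G : ℝ)) =
        (s : ℝ) * B v v - (s : ℝ) ^ 2 / (Fintype.card G : ℝ) * ∑ w, B v w := by
    intro v _
    simp only [mul_sub, Finset.sum_sub_distrib, mul_ite, mul_zero]
    rw [Finset.sum_ite_eq]
    simp only [Finset.mem_univ, if_true]
    rw [Finset.mul_sum]
    congr 1
    · ring
    · apply Finset.sum_congr rfl; intro w _; ring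
  rw [Finset.sum_congr rfl h2, Finset.sum_sub_distrib, ← Finset.mul_sum, ← Finset.mul_sum]

end Summit.MatrixMultiplication.MatrixMultiplication.Theorems.PrimeCyclicPowerGainTheta.Fluct

namespace Summit.MatrixMultiplication.MatrixMultiplication.Theorems.PrimeCyclicPowerGainTheta.Fluct

open scoped BigOperators

/-- **Registered milestone stub `stub_thetaFluctEnergy`** (crux stmt-MatrixMultiplication-14309, line
clique-coclique-direct-sum-clique; milestone 1a of the bet `stub_thetaBound`): the `A`-side fluctuation-energy
identity in closed form — for a kernel on block pairs whose nonzero entries sit on blocks with first sides of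
size `s`, pairwise disjoint across distinct blocks,
`Σ_y Σ_{v,w} (1_{v.1}(y) − |v.1|/|G|) B_vw (1_{w.1}(y) − |w.1|/|G|) = s · Σ_v B_vv − (s²/|G|) · Σ_{v,w} B_vw`. -/
theorem stub_thetaFluctEnergy :
    ∀ (G : Type) [AddCommGroup G] [Fintype G] [DecidableEq G] (s : ℕ)
      (B : Finset G × Finset G → Finset G × Finset G → ℝ),
      (∀ v w : Finset G × Finset G, B v w ≠ 0 → v.1.card = s ∧ w.1.card = s) →
      (∀ v w : Finset G × Finset G, B v w ≠ 0 → v ≠ w → Disjoint v.1 w.1) →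
      ∑ y, ∑ v, ∑ w,
          ((if y ∈ v.1 then (1 : ℝ) else 0) - (v.1.card : ℝ) / (Fintype.card G : ℝ)) * B v w *
            ((if y ∈ w.1 then (1 : ℝ) else 0) - (w.1.card : ℝ) / (Fintype.card G : ℝ)) =
        (s : ℝ) * ∑ v, B v v - (s : ℝ) ^ 2 / (Fintype.card G : ℝ) * ∑ v, ∑ w, B v w :=
  fun G _ _ _ s B hcA hdA => fluctA_energy (G := G) s B hcA hdA

end Summit.MatrixMultiplication.MatrixMultiplication.Theorems.PrimeCyclicPowerGainTheta.Fluct
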